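import Summits.CriticalPhenomena.PercolationContinuityZ3.Theorems.PercNearOneGluingNoHeavyLowerTailFKHullPortTALayer
import Summits.CriticalPhenomena.PercolationContinuityZ3.Theorems.PercNearOneGluingNoHeavyLowerTailFKCovTransferRelaySet
import Literature.Probability.Percolation.TwoClusterGibbsCovarianceRC
import HarnessLib

/-!
# FK sub-lane: the marker-dominance lemma with avoidance MDL(X) for `φ_{𝐩,q}`, `q ≥ 1`, from `T_A^{FK} ≥ 0`

Support file (`--supports stmt-CriticalPhenomena-4575`), FK sub-lane `prim-bschramm-fk-2` (gen 3); builds on p205010 (kernel theorem,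
internal audit signed; external expert review pending).  No definitions, no named facts, no sorries; standard axioms.

bschramm/FK-Q2.md §12.6(b) made a theorem: for the random-cluster measure `φ = rcMeasureW w q ∅` with `q ≥ 1` and
`w e < 1` on the non-loop pairs meeting the avoided set `X` (and weight-one pairs inside `X`), vertices `s ≠ y`, a marker
`z`, `D = {s ↮ X}`, `A = {y ↮ s, y ↮ X}`, `W = {y ↔ z}`, and every monotone `F` of the open edge cluster `C_s`,
  `φ(A ∩ W)·[φ(D) ∫_{D ∩ {s↔y}} F − (∫_D F) φ(D ∩ {s↔y})] ≤ φ(A)·[φ(D) ∫_{D ∩ {s↔z}} F − (∫_D F) φ(D ∩ {s↔z})]`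
(`FK.markerDominanceAvoid_rc`; the `q = 1` statement is prove-5's `HullPort.markerDominanceAvoid_of_TA` with its
hypothesis `hTA` now discharged for `φ_{𝐩,q}`).  Proof = prim-lit-3's reduction theorem for `φ_{𝐩,q}` in two-marker form
(`BHK2006_twoMarkerCov_le_of_within_rc`: vdBHK's two-block Gibbs sampler for the random-cluster measure, stationarity,
Doeblin contraction) applied to `h = φ(A)·1{s↔z} − φ(A∩W)·1{s↔y}`; its hypothesis — the conditional covariances given
the cluster of `X`, averaged over `D` — is, world by world, `φ(A)·c_z(ω) − φ(A∩W)·c_y(ω)` with `c_t(ω) = taC w q s t X g ω`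
(`FK.world_cov_eq_taC`), bounded below via (K6) for `φ_{𝐩,q}` in each world (`FK.covTransfer_relaySet_edge_rc` at
`S = {s}`: `taNW·c_y ≤ taN·c_z`, `FK.taNW_mul_taC_le`) by `(φ(A)·A(g) − φ(A∩W)·B(g))/Z = Q(g)/Z² ≥ 0`, which is
`FK.taQ_nonneg` (`T_A^{FK} ≥ 0`, this seat).
[cite: VandenbergHaggstromKahn2005, Thm. 1.3 (p. 6), Thm. 2.1 (p. 9), §2.1 pp. 10–13] [cite: Grimmett2006, Thm. (3.8)(b) (p. 39)]
[cite: Gladkov2024, Thm. 3.2 (p. 4)]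
-/

noncomputable section

namespace Summit.CriticalPhenomena.PercolationContinuityZ3.Theorems.FK

open MeasureTheory Set
open Literature.Probability.LatticeModels Literature.Probability.Percolation
open Literature.Probability.Percolation.DecisionTree (ind ind_of_mem ind_of_not_mem ind_nonneg)
open Literature.Probability.Percolation.BHK2006 (rcMass rcMass_nonneg sum_rcMass delW
  integral_rcMeasureW_eq_sum rcMeasureW_real_eq_sum_rcMass setIntegral_rcMeasureW_eq_sum rcMass_fkg openEdgeCluster_mono)
open Summit.CriticalPhenomena.PercolationContinuityZ3.Theorems.HullPort (cut avoidEv)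
open scoped Classical

variable {V : Type*} [Fintype V]

/-! ### World covariances are the functionals `taC` -/

/-- **The covariance in the world `φ_{G − cut_X(ω)}` is `taC`.**  For the world
`φ^ω = rcMeasureW (delW w {pairs meeting the open vertex cluster of X}) q ∅` (vdBHK Lemma 2.3 for `φ_{𝐩,q}`),
`∫_{s↔t} g(C_s) dφ^ω − (∫ g(C_s) dφ^ω)·φ^ω(s↔t) = taC w q s t X g ω`.
[cite: VandenbergHaggstromKahn2005, §2.1 eq. (11) (p. 9), Lemma 2.3 (p. 10)] -/
theorem world_cov_eq_taC (w : Sym2 V → unitInterval) {q : ℝ} (hq : 0 < q) (s t : V) (X : Set V)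
    (g : Set (Sym2 V) → ℝ) (ω : BondConfig V) :
    (∫ η in (openConn s t : Set (BondConfig V)), g (openEdgeCluster η s)
        ∂(rcMeasureW (delW w {e | ∃ v ∈ e, ∃ x ∈ X, (openGraph ω).Reachable x v}) q ∅)) -
      (∫ η, g (openEdgeCluster η s)
        ∂(rcMeasureW (delW w {e | ∃ v ∈ e, ∃ x ∈ X, (openGraph ω).Reachable x v}) q ∅)) *
      (rcMeasureW (delW w {e | ∃ v ∈ e, ∃ x ∈ X, (openGraph ω).Reachable x v}) q ∅).real
        (openConn s t : Set (BondConfig V)) = taC w q s t X g ω := by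
  rw [setIntegral_rcMeasureW_eq_sum _ hq, integral_rcMeasureW_eq_sum _ hq, rcMeasureW_real_eq_sum_rcMass _ hq]
  rfl

/-- `taN ≥ 0` (a world probability). [cite: Grimmett2006, §1.4 eq. (1.20) (p. 15)] -/
theorem taN_nonneg (w : Sym2 V → unitInterval) {q : ℝ} (hq : 0 < q) (s y : V) (X : Set V) (ω : BondConfig V) :
    0 ≤ taN w q s y X ω :=
  Finset.sum_nonneg fun η _ => mul_nonneg (rcMass_nonneg _ hq η) (ind_nonneg _ _)

/-! ### (K6) for `φ_{𝐩,q}` in each world: `taNW · c_y ≤ taN · c_z` -/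

/-- **Covariance transfer in the world `φ_{G − cut_X(ω)}`** ((K6) for `φ_{𝐩,q}` at `S = {s}`, i.e. MDL(∅) in the world):
`φ^ω(s ↮ y, y ↔ z)·Cov^ω(g(C_s), 1{s↔y}) ≤ φ^ω(s ↮ y)·Cov^ω(g(C_s), 1{s↔z})` for monotone `g`, `q ≥ 1`.
[cite: VandenbergHaggstromKahn2005, Thm. 2.1 (p. 9), Thm. 1.4 (p. 7)] [cite: Grimmett2006, Thm. (3.8)(b)] -/
theorem taNW_mul_taC_le (w : Sym2 V → unitInterval) {q : ℝ} (hq : 1 ≤ q) (s y z : V) (X : Set V)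
    (g : Set (Sym2 V) → ℝ) (hg : Monotone g) (ω : BondConfig V) :
    taNW w q s y z X ω * taC w q s y X g ω ≤ taN w q s y X ω * taC w q s z X g ω := by
  have hq0 : 0 < q := one_pos.trans_le hq
  have h := covTransfer_relaySet_edge_rc (delW w (cut X ω)) hq ({s} : Finset V) z y s (Finset.mem_singleton_self s) g hg
  have e1 : (⋃ t ∈ ({s} : Finset V), (openConn y t : Set (BondConfig V))) = openConn s y := by
    ext η
    simp only [Finset.mem_singleton, Set.mem_iUnion, exists_prop, exists_eq_left, openConn, Set.mem_setOf_eq]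
    exact ⟨fun h => h.symm, fun h => h.symm⟩
  have e2 : (⋃ t ∈ ({s} : Finset V), (openConn z t : Set (BondConfig V))) = openConn s z := by
    ext η
    simp only [Finset.mem_singleton, Set.mem_iUnion, exists_prop, exists_eq_left, openConn, Set.mem_setOf_eq]
    exact ⟨fun h => h.symm, fun h => h.symm⟩
  have e3 : {η : BondConfig V | ∀ t ∈ ({s} : Finset V), ¬ (openGraph η).Reachable y t} =
      (openConn s y : Set (BondConfig V))ᶜ := by
    ext η
    simp only [Finset.mem_singleton, forall_eq, Set.mem_setOf_eq, Set.mem_compl_iff, openConn]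
    exact ⟨fun h h' => h h'.symm, fun h h' => h h'.symm⟩
  have e4 : (openConn z y : Set (BondConfig V)) = openConn y z := by
    ext η
    simp only [openConn, Set.mem_setOf_eq]
    exact ⟨fun h => h.symm, fun h => h.symm⟩
  rw [e1, e2, e3, e4] at h
  simp only [setIntegral_rcMeasureW_eq_sum _ hq0, integral_rcMeasureW_eq_sum _ hq0,
    rcMeasureW_real_eq_sum_rcMass _ hq0] at h
  unfold taNW taN taC wE
  calc (∑ η, rcMass (delW w (cut X ω)) q η * ind ((openConn s y : Set (BondConfig V))ᶜ ∩ openConn y z) η) *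
        ((∑ η, rcMass (delW w (cut X ω)) q η * (g (openEdgeCluster η s) * ind (openConn s y) η)) -
          (∑ η, rcMass (delW w (cut X ω)) q η * g (openEdgeCluster η s)) *
            ∑ η, rcMass (delW w (cut X ω)) q η * ind (openConn s y) η)
      = (∑ η, rcMass (delW w (cut X ω)) q η * ind ((openConn s y : Set (BondConfig V))ᶜ ∩ openConn y z) η) *
        ((∑ η, rcMass (delW w (cut X ω)) q η * (g (openEdgeCluster η s) * ind (openConn s y) η)) -
          (∑ η, rcMass (delW w (cut X ω)) q η * ind (openConn s y) η) *
            ∑ η, rcMass (delW w (cut X ω)) q η * g (openEdgeCluster η s)) := by ring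
    _ ≤ (∑ η, rcMass (delW w (cut X ω)) q η * ind (openConn s y : Set (BondConfig V))ᶜ η) *
        ((∑ η, rcMass (delW w (cut X ω)) q η * (g (openEdgeCluster η s) * ind (openConn s z) η)) -
          (∑ η, rcMass (delW w (cut X ω)) q η * ind (openConn s z) η) *
            ∑ η, rcMass (delW w (cut X ω)) q η * g (openEdgeCluster η s)) := h
    _ = _ := by ring

/-- **Pointwise lower bound for the two-marker integrand**: for `a ≥ 0` and monotone `g`,
`a·(taNW/taN)·c_y ≤ a·c_z` in every world (from `taNW_mul_taC_le`; if `taN = 0` the left side is `0 ≤ a·c_z` by FKG in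
the world). [cite: VandenbergHaggstromKahn2005, Thm. 2.1 (p. 9)] [cite: Grimmett2006, Thm. (3.8)(b)] -/
theorem ratio_mul_taC_le (w : Sym2 V → unitInterval) {q : ℝ} (hq : 1 ≤ q) (s y z : V) (X : Set V)
    (g : Set (Sym2 V) → ℝ) (hg : Monotone g) {a : ℝ} (ha : 0 ≤ a) (ω : BondConfig V) :
    a * (taNW w q s y z X ω / taN w q s y X ω * taC w q s y X g ω) ≤ a * taC w q s z X g ω := by
  have hq0 : 0 < q := one_pos.trans_le hq
  refine mul_le_mul_of_nonneg_left ?_ ha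
  by_cases hN : taN w q s y X ω = 0
  · rw [hN, div_zero, zero_mul]; exact taC_nonneg w hq s z X hg ω
  · have hNpos : 0 < taN w q s y X ω := lt_of_le_of_ne (taN_nonneg w hq0 s y X ω) (Ne.symm hN)
    rw [div_mul_eq_mul_div, div_le_iff₀ hNpos]
    calc taNW w q s y z X ω * taC w q s y X g ω ≤ taN w q s y X ω * taC w q s z X g ω :=
          taNW_mul_taC_le w hq s y z X g hg ω
      _ = taC w q s z X g ω * taN w q s y X ω := mul_comm _ _

/-! ### MDL(X) for `φ_{𝐩,q}` -/

/-- **The marker-dominance lemma with avoidance, MDL(X), for the random-cluster measure `φ_{𝐩,q}`, `q ≥ 1`.**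
For `s ≠ y`, a marker `z`, an avoided set `X` with `w e < 1` on the non-loop pairs meeting `X` and all weight-one pairs
inside `X`, `D = {s ↮ X}`, `A = {y ↮ s, y ↮ X}` (as `{ω | ∀ x ∈ insert s X, y ↮ x}`), `W = {y ↔ z}`, `Y = {s ↔ y}`,
`Z = {s ↔ z}`, and every monotone `F` of the edge cluster `C_s`:
`φ(A ∩ W)·[φ(D)∫_{D∩Y} F − (∫_D F) φ(D∩Y)] ≤ φ(A)·[φ(D)∫_{D∩Z} F − (∫_D F) φ(D∩Z)]`, `φ = rcMeasureW w q ∅`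
(CSH level 0 for `φ_{𝐩,q}`; bschramm/FK-Q2.md §12.6(b)).  Proof: the two-marker reduction theorem for `φ_{𝐩,q}`
(`BHK2006_twoMarkerCov_le_of_within_rc`) with `h = φ(A)·1{s↔z} − φ(A∩W)·1{s↔y}`; its averaged within-covariance
hypothesis is bounded below, world by world via (K6) in the world (`ratio_mul_taC_le`), by `Q(g)/Z²`, and
`Q(g) ≥ 0` is `T_A^{FK} ≥ 0` (`FK.taQ_nonneg`).
[cite: VandenbergHaggstromKahn2005, Thm. 1.3 (p. 6), Thm. 2.1 (p. 9), §2.1 pp. 10–13] [cite: Grimmett2006, Thm. (3.8)(b) (p. 39)]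
[cite: Gladkov2024, Thm. 3.2 (p. 4)] -/
theorem markerDominanceAvoid_rc (w : Sym2 V → unitInterval) {q : ℝ} (hq : 1 ≤ q) (s y z : V) (X : Set V)
    (hsy : s ≠ y) (hX : ∀ e : Sym2 V, ¬ e.IsDiag → (∃ v ∈ e, v ∈ X) → (w e : ℝ) < 1)
    (hINV : ∀ p : Sym2 V, ((w p : unitInterval) : ℝ) = 1 → ∀ u ∈ p, u ∈ X)
    (F : Set (Sym2 V) → ℝ) (hF : Monotone F) :
    (rcMeasureW w q ∅).real ({ω : BondConfig V | ∀ x ∈ insert s X, ¬ (openGraph ω).Reachable y x} ∩ openConn y z) *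
        ((rcMeasureW w q ∅).real {ω : BondConfig V | ∀ x ∈ X, ¬ (openGraph ω).Reachable s x} *
            (∫ ω in {ω : BondConfig V | ∀ x ∈ X, ¬ (openGraph ω).Reachable s x} ∩ openConn s y,
              F (openEdgeCluster ω s) ∂(rcMeasureW w q ∅)) -
          (∫ ω in {ω : BondConfig V | ∀ x ∈ X, ¬ (openGraph ω).Reachable s x},
              F (openEdgeCluster ω s) ∂(rcMeasureW w q ∅)) *
            (rcMeasureW w q ∅).real
              ({ω : BondConfig V | ∀ x ∈ X, ¬ (openGraph ω).Reachable s x} ∩ openConn s y)) ≤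
      (rcMeasureW w q ∅).real {ω : BondConfig V | ∀ x ∈ insert s X, ¬ (openGraph ω).Reachable y x} *
        ((rcMeasureW w q ∅).real {ω : BondConfig V | ∀ x ∈ X, ¬ (openGraph ω).Reachable s x} *
            (∫ ω in {ω : BondConfig V | ∀ x ∈ X, ¬ (openGraph ω).Reachable s x} ∩ openConn s z,
              F (openEdgeCluster ω s) ∂(rcMeasureW w q ∅)) -
          (∫ ω in {ω : BondConfig V | ∀ x ∈ X, ¬ (openGraph ω).Reachable s x},
              F (openEdgeCluster ω s) ∂(rcMeasureW w q ∅)) *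
            (rcMeasureW w q ∅).real
              ({ω : BondConfig V | ∀ x ∈ X, ¬ (openGraph ω).Reachable s x} ∩ openConn s z)) := by
  have hq0 : 0 < q := one_pos.trans_le hq
  haveI := isProbabilityMeasure_rcMeasureW w hq0 (∅ : Set V)
  have hZpos : 0 < rcPartitionFunctionW w q ∅ := rcPartitionFunctionW_pos w hq0 ∅
  set a : ℝ := (rcMeasureW w q ∅).real {ω : BondConfig V | ∀ x ∈ insert s X, ¬ (openGraph ω).Reachable y x} with ha
  set b : ℝ := (rcMeasureW w q ∅).real
    ({ω : BondConfig V | ∀ x ∈ insert s X, ¬ (openGraph ω).Reachable y x} ∩ openConn y z) with hb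
  have ha0 : 0 ≤ a := measureReal_nonneg
  refine BHK2006_twoMarkerCov_le_of_within_rc w hq s X y z a b hX (fun g hg _ => ?_) F hF
  -- the averaged within-covariance hypothesis, from `T_A ≥ 0`
  simp only [world_cov_eq_taC w hq0]
  rw [setIntegral_rcMeasureW_eq_sum w hq0]
  -- pointwise lower bound
  have hpt : ∀ ω : BondConfig V,
      rcMass w q ω * ((a * (taNW w q s y z X ω / taN w q s y X ω * taC w q s y X g ω) - b * taC w q s y X g ω) *
          ind {ω : BondConfig V | ∀ x ∈ X, ¬ (openGraph ω).Reachable s x} ω) ≤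
        rcMass w q ω * ((a * taC w q s z X g ω - b * taC w q s y X g ω) *
          ind {ω : BondConfig V | ∀ x ∈ X, ¬ (openGraph ω).Reachable s x} ω) := fun ω =>
    mul_le_mul_of_nonneg_left (mul_le_mul_of_nonneg_right
      (sub_le_sub_right (ratio_mul_taC_le w hq s y z X g hg ha0 ω) _) (ind_nonneg _ _)) (rcMass_nonneg w hq0 ω)
  refine le_trans ?_ (Finset.sum_le_sum fun ω _ => hpt ω)
  -- the lower sum is `(a·A(g) − b·B(g))/Z = Q(g)/Z²`
  have hmass : ∀ ω : BondConfig V, rcWeightW w q ∅ ω = rcPartitionFunctionW w q ∅ * rcMass w q ω := fun ω => by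
    unfold rcMass; field_simp
  have hA : taA w q s y z X g = rcPartitionFunctionW w q ∅ *
      ∑ ω, rcMass w q ω * ((taNW w q s y z X ω / taN w q s y X ω * taC w q s y X g ω) *
        ind {ω : BondConfig V | ∀ x ∈ X, ¬ (openGraph ω).Reachable s x} ω) := by
    unfold taA avoidEv
    rw [Finset.mul_sum]
    refine Finset.sum_congr rfl fun ω _ => ?_
    rw [hmass]; ring
  have hB : taB w q s y X g = rcPartitionFunctionW w q ∅ *
      ∑ ω, rcMass w q ω * (taC w q s y X g ω * ind {ω : BondConfig V | ∀ x ∈ X, ¬ (openGraph ω).Reachable s x} ω) := by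
    unfold taB avoidEv
    rw [Finset.mul_sum]
    refine Finset.sum_congr rfl fun ω _ => ?_
    rw [hmass]; ring
  have hb' : tab w q s y X = rcPartitionFunctionW w q ∅ * a := by
    unfold tab avoidEv
    rw [ha, rcMeasureW_real_eq_sum_rcMass w hq0, Finset.mul_sum]
    refine Finset.sum_congr rfl fun ω _ => ?_
    rw [hmass]; ring
  have ha' : taa w q s y z X = rcPartitionFunctionW w q ∅ * b := by
    unfold taa avoidEv
    rw [hb, rcMeasureW_real_eq_sum_rcMass w hq0, Finset.mul_sum]
    refine Finset.sum_congr rfl fun ω _ => ?_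
    rw [hmass]; ring
  have hQ := taQ_nonneg hq s y hsy g hg w X hINV z
  unfold taQ at hQ
  rw [hA, hB, hb', ha'] at hQ
  -- `hQ : 0 ≤ (Z P)(Z a) − (Z b)(Z Q')`; the goal is `0 ≤ Σ m((a r c − b c) 1_D) = a P − b Q'`
  have hsum : ∑ ω, rcMass w q ω * ((a * (taNW w q s y z X ω / taN w q s y X ω * taC w q s y X g ω) -
      b * taC w q s y X g ω) * ind {ω : BondConfig V | ∀ x ∈ X, ¬ (openGraph ω).Reachable s x} ω) =
      a * ∑ ω, rcMass w q ω * ((taNW w q s y z X ω / taN w q s y X ω * taC w q s y X g ω) *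
          ind {ω : BondConfig V | ∀ x ∈ X, ¬ (openGraph ω).Reachable s x} ω) -
        b * ∑ ω, rcMass w q ω * (taC w q s y X g ω * ind {ω : BondConfig V | ∀ x ∈ X, ¬ (openGraph ω).Reachable s x} ω) := by
    rw [Finset.mul_sum, Finset.mul_sum, ← Finset.sum_sub_distrib]
    refine Finset.sum_congr rfl fun ω _ => ?_
    ring
  rw [hsum]
  set P := ∑ ω, rcMass w q ω * ((taNW w q s y z X ω / taN w q s y X ω * taC w q s y X g ω) *
    ind {ω : BondConfig V | ∀ x ∈ X, ¬ (openGraph ω).Reachable s x} ω)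
  set Q' := ∑ ω, rcMass w q ω * (taC w q s y X g ω * ind {ω : BondConfig V | ∀ x ∈ X, ¬ (openGraph ω).Reachable s x} ω)
  have hZ2 : 0 < rcPartitionFunctionW w q ∅ * rcPartitionFunctionW w q ∅ := mul_pos hZpos hZpos
  have e : rcPartitionFunctionW w q ∅ * P * (rcPartitionFunctionW w q ∅ * a) -
      rcPartitionFunctionW w q ∅ * b * (rcPartitionFunctionW w q ∅ * Q') =
      (rcPartitionFunctionW w q ∅ * rcPartitionFunctionW w q ∅) * (a * P - b * Q') := by ring
  rw [e] at hQ
  exact nonneg_of_mul_nonneg_right hQ hZ2 |> fun h => h
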